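import Summits.NavierStokesRegularity.NavierStokesRegularity.Theses.AxisymmetricExtremality
import Literature.Analysis.FluidPDE.KatoSymmetryCovariance
import Literature.Analysis.FluidPDE.RusinSverakCompactnessProofs

/-!
# Route AxisymmetricExtremality — crux `MinimalDatumPFold` (stmt-NavierStokesRegularity-15452), stub `stub_liftRecentre`

Registered stub of the line `registered` (`Cruxes/MinimalDatumPFold/Lines/birth.lean`, lead c1 reshape).
Target tree file: `Summits/NavierStokesRegularity/NavierStokesRegularity/Theorems/AxisymmetricExtremalityMinimalDatumPFoldRecentre.lean`.
Proof summary: solve `R e - e = x₀` for a horizontal `e` (possible since `cos (2π/p) ≠ 1` for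
`p ≥ 2`), translate the datum by `e` (`u₁ = u₀ (· + e)`, a minimal blow-up datum again by
`IsMinimalBlowupDatum.rescaleData_translate` + `exists_represents_rescaleData_norm_eq`), and transport
the a.e. equivariance along the measure-preserving translation `x ↦ x + e`.
-/

set_option linter.dupNamespace false

noncomputable section

open MeasureTheory Set Function Filter Topology
open scoped ENNReal NNReal

namespace Summit.NavierStokesRegularity.NavierStokesRegularity.Theorems

/-- **Recentring the axis of a discretely rotation-equivariant minimal blow-up datum.**
Let `(u₀, g)` be a Rusin–Šverák minimal blow-up datum (`IsMinimalBlowupDatum ν u₀ g`) with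
`u₀ (R x - x₀) = R (u₀ x)` for a.e. `x`, where `R = R_{2π/p}` is the rotation about the `x 2`-axis
by `2π/p` (`p ≥ 2`) and the defect `x₀` is horizontal (`x₀ 2 = 0`). Then some minimal blow-up
datum `(u₁, g₁)` is a.e. `R`-equivariant about the axis itself: `u₁ (R x) = R (u₁ x)` a.e.
Proof: with `c = cos (2π/p) ≠ 1` (as `0 < 2π/p ≤ π`), `s = sin (2π/p)` and
`d = (c - 1)² + s² > 0`, the horizontal vector
`e = (((c-1) x₀⁰ + s x₀¹)/d, (-s x₀⁰ + (c-1) x₀¹)/d, 0)` solves `R e - e = x₀`, so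
`u₁ := u₀ (· + e)` (the translate `rescaleData 1 (u₀ (· - (-e)))`) satisfies
`u₁ (R x) = u₀ (R (x + e) - x₀) = R (u₀ (x + e)) = R (u₁ x)` for a.e. `x` (translations preserve
Lebesgue measure), and it is again a minimal blow-up datum by the translation invariance of
Rusin–Šverák's set `M` (`IsMinimalBlowupDatum.rescaleData_translate` with the norm-preserving
representative of `exists_represents_rescaleData_norm_eq`).
[cite: RusinSverak2011, Cor. 4.3 (arXiv:0911.0500 p. 8) with §1 (p. 3)] -/
theorem stub_liftRecentre :
    ∀ (ν : ℝ) (p : ℕ), 2 ≤ p → ∀ (u₀ : EuclideanSpace ℝ (Fin 3) → EuclideanSpace ℝ (Fin 3)) (g : Literature.Analysis.FunctionSpaces.HomSobolev (EuclideanSpace ℝ (Fin 3)) (EuclideanSpace ℂ (Fin 3)) (1 / 2 : ℝ)), Literature.Analysis.FluidPDE.IsMinimalBlowupDatum ν u₀ g → ∀ x₀ : EuclideanSpace ℝ (Fin 3), x₀ 2 = 0 → (∀ᵐ x ∂(MeasureTheory.volume : MeasureTheory.Measure (EuclideanSpace ℝ (Fin 3))), u₀ (WithLp.toLp 2 ![Real.cos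 (2 * Real.pi / p) * x 0 - Real.sin (2 * Real.pi / p) * x 1, Real.sin (2 * Real.pi / p) * x 0 + Real.cos (2 * Real.pi / p) * x 1, x 2] - x₀) = WithLp.toLp 2 ![Real.cos (2 * Real.pi / p) * u₀ x 0 - Real.sin (2 * Real.pi / p) * u₀ x 1, Real.sin (2 * Real.pi / p) * u₀ x 0 + Real.cos (2 * Real.pi / p) * u₀ x 1, u₀ x 2]) → ∃ (u₁ : EuclideanSpace ℝ (Fin 3) → EuclideanSpace ℝ (Fin 3)) (g₁ : Literature.Analysis.FunctionSpaces.HomSobolev (EuclideanSpace ℝ (Fin 3)) (EuclideanSpace ℂ (Fin 3)) (1 / 2 : ℝ)), Literature.Analysis.FluidPDE.IsMinimalBlowupDatum ν u₁ g₁ ∧ ∀ᵐ x ∂(MeasureTheory.volume : MeasureTheory.Measure (EuclideanSpace ℝ (Fin 3))), u₁ (WithLp.toLp 2 ![Real.cos (2 * Real.pi / p) * x 0 - Real.sin (2 * Real.pi / p) * x 1, Real.sin (2 * Real.pi / p) * x 0 + Real.cos (2 * Real.pi / p) * x 1, x 2]) = WithLp.toLp 2 ![Real.cos (2 * Real.pi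 / p) * u₁ x 0 - Real.sin (2 * Real.pi / p) * u₁ x 1, Real.sin (2 * Real.pi / p) * u₁ x 0 + Real.cos (2 * Real.pi / p) * u₁ x 1, u₁ x 2] := by
  intro ν p hp u₀ g hmin x₀ hx₀ hae
  set c : ℝ := Real.cos (2 * Real.pi / p) with hc_def
  set s : ℝ := Real.sin (2 * Real.pi / p) with hs_def
  -- `c ≠ 1` since `0 < 2π/p ≤ π < 2π`
  have hp2 : (2 : ℝ) ≤ p := by exact_mod_cast hp
  have hp0 : (0 : ℝ) < p := by linarith
  have hθpos : 0 < 2 * Real.pi / p := div_pos (by positivity) hp0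
  have hθle : 2 * Real.pi / p ≤ Real.pi := by
    rw [div_le_iff₀ hp0]
    nlinarith [Real.pi_pos]
  have hc1 : c ≠ 1 := by
    intro h
    have h0 : 2 * Real.pi / p = 0 :=
      (Real.cos_eq_one_iff_of_lt_of_lt (by linarith [Real.pi_pos]) (by linarith [Real.pi_pos])).1 h
    exact hθpos.ne' h0
  have hdpos : 0 < (c - 1) ^ 2 + s ^ 2 := by
    have h1 : c - 1 ≠ 0 := sub_ne_zero.2 hc1
    positivity
  have hd0 : (c - 1) ^ 2 + s ^ 2 ≠ 0 := hdpos.ne'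
  -- the new centre `e`, the solution of `R e - e = x₀`
  set e : EuclideanSpace ℝ (Fin 3) :=
    WithLp.toLp 2 ![((c - 1) * x₀ 0 + s * x₀ 1) / ((c - 1) ^ 2 + s ^ 2),
      (-s * x₀ 0 + (c - 1) * x₀ 1) / ((c - 1) ^ 2 + s ^ 2), 0] with he_def
  have key : ∀ x : EuclideanSpace ℝ (Fin 3),
      (WithLp.toLp 2 ![c * x 0 - s * x 1, s * x 0 + c * x 1, x 2] : EuclideanSpace ℝ (Fin 3)) + e =
        WithLp.toLp 2 ![c * (x + e) 0 - s * (x + e) 1, s * (x + e) 0 + c * (x + e) 1, (x + e) 2]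
          - x₀ := by
    intro x
    ext i
    fin_cases i
    · simp only [he_def]
      simp
      field_simp
      ring
    · simp only [he_def]
      simp
      field_simp
      ring
    · simp [he_def, hx₀]
  -- the translated datum is again minimal
  obtain ⟨g₁, hg₁, hnorm⟩ :=
    Literature.Analysis.FluidPDE.exists_represents_rescaleData_norm_eq u₀ g one_pos (-e) hmin.2.1
  refine ⟨Literature.Analysis.FluidPDE.rescaleData 1 (fun x => u₀ (x - -e)), g₁,
    hmin.rescaleData_translate one_pos (-e) hg₁ hnorm, ?_⟩
  -- transport the a.e. equivariance along the translation `x ↦ x + e`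
  have hae' := (measurePreserving_add_right
    (volume : MeasureTheory.Measure (EuclideanSpace ℝ (Fin 3))) e).quasiMeasurePreserving.ae hae
  filter_upwards [hae'] with x hx
  simp only [Literature.Analysis.FluidPDE.rescaleData_apply, one_smul, sub_neg_eq_add]
  rw [key x]
  exact hx

end Summit.NavierStokesRegularity.NavierStokesRegularity.Theorems

end
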